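import Summits.BirchSwinnertonDyer.BirchSwinnertonDyer.Theorems.ErratumRoadFiveNonSurjCornerTamagawaExponent
import Literature.NumberTheory.EllipticCurves.LangHeightNonarchEstimate
import Summits.BirchSwinnertonDyer.BirchSwinnertonDyer.Theorems.ErratumRoadFiveNonSurjCornerKolyJTamZero
import HarnessLib

/-!
# Route `ErratumRoadFive` (rung K2), crux child `NonSurjCornerKolyJ` (item stmt-BirchSwinnertonDyer-19947,
# parent 19065 `NonSurjCorner`): THE REGISTERED STUB `stub_kolyJ_max` NEEDS ONLY THE SPLIT MULTIPLICATIVE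
# PLACES — at every other place `ord_p c_v = 0` on the corner, so the MAX form there is `PDiv d p 0`; and the
# split places separate into the corner prime `v ∣ p` (split at `p`, `p ∣ c_p`, a `ℚ_p`-rational `p`-torsion
# point) and the split `ℓ ≠ p` (`E[p]` UNRAMIFIED at `ℓ`, `c_ℓ = ord_ℓ Δ_min ≡ 0 mod p`)
# (cell `bsd-stepL`, seat `bsd-stepL-corner5-p2` g4, WIDTH-LEVER lane B; `--supports stmt-BirchSwinnertonDyer-19947
# --as helper`)

WHY THIS FILE. The skeleton of record of child 19947 (`Cruxes/NonSurjCornerKolyJ/Lines/birth.lean`, e8f00c7911bf)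
registers `stub_kolyJ_max`: «for EVERY finite place `v` of `ℚ` and every `s ≤ ord_p c_v(E/ℚ) = padicValNat p
(W.tamagawaNumberAt v)`, every derived Heegner point at a Kolyvagin level of index `≥ s` is `p^s`-divisible».
By this seat's `…NonSurjCornerTamagawaExponent` ∕ `…Carriers` (p556060 ∕ p557941) the carriers of `t` on the
corner are EXACTLY the split multiplicative places: at a good, additive or NON-split multiplicative place `ord_p c_v = 0` (`p ≥ 5`), so there
the stub asks only for `PDiv d p 0`, which always holds (`Koly.pdiv_zero`). Hence (this file, pure logic on
landed theorems, nothing asserted about any curve):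

* `nonSurjCornerKolyJ_max_of_splitPlaces` — **`stub_kolyJ_max` VERBATIM ⟸ its restriction to the places `v` of
  SPLIT multiplicative reduction**, where the supplier may moreover ASSUME `c_v = ord_v(Δ_min)` and
  `p ∣ ord_v(Δ_min)` (both kernel facts on the corner);
* `nonSurjCornerKolyJ_max_of_atP_of_awayP` — the same with the split places separated into the two cases lane A
  treats by different arguments (CORNER-G7 §1): **(at `p`)** `v ∣ p` split multiplicative — the corner prime,
  where Jetchev's Prop. 4.9 is replaced by the component-group argument (`p ∣ c_p = ord_p Δ_min`, and `E(ℚ_p)`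
  HAS a point of order `p`: this seat's `NonSurjCorner.exists_fixed_torsion_of_split`, supplied to the supplier
  as a hypothesis it may use), and **(away from `p`)** `v ∤ p` split multiplicative — the classical Jetchev
  setting except for the image: `E[p]` is UNRAMIFIED at `ℓ` (`p ∣ ord_ℓ Δ_min`, i.e. `¬ Ram`), `c_ℓ = ord_ℓ Δ_min`.
Converse directions are trivial (the verbatim stub specialises to both restrictions) and not recorded.

HONEST FRAMING: two theorems (no definition, no named fact, no `sorry`); `stub_kolyJ_max` is NOT proved — it is
REDUCED to its genuine content; nothing about BSD; no census label moves (T7). Census (lane A CORNER-G3, `p = 5`):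
the «at `p`» case concerns the 35 split-at-5 pairs, the «away» case the 8 pairs with a split `ℓ ≠ 5`
(21660u1: 3; 59040bf1 ∕ bg1: 41; 84960d1 ∕ z1, 169920dc1: 59; 296240ce1: 7; 304560by1: 47).
References: [Jetchev2008] Thm. 1.4, Prop. 4.9, Lemma 4.3 (the local conditions at `v ∣ N`); [McCallumLMS1991] §5;
tree: `Cruxes/NonSurjCornerKolyJ/Lines/birth.lean` (stub of record), `Theorems/ErratumRoadFiveNonSurjCorner
{TamagawaExponent,TamagawaCarriers,TateParameter,KolyJTamZero}.lean`.
-/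

set_option linter.dupNamespace false -- `Summit.BirchSwinnertonDyer.BirchSwinnertonDyer` (summit = problem), tree-wide
set_option autoImplicit false

noncomputable section

open scoped Classical NumberField

namespace Summit.BirchSwinnertonDyer.BirchSwinnertonDyer.Theorems

open WeierstrassCurve NumberField IsDedekindDomain Field Rat.HeightOneSpectrum
  Literature.NumberTheory.EllipticCurves
  Literature.NumberTheory.EllipticCurves.ModularForms
  Literature.NumberTheory.EllipticCurves.Rank1Residual
  Literature.NumberTheory.QuadraticFields.Quadratic
  Summit.BirchSwinnertonDyer.Rank1Residual
  Summit.BirchSwinnertonDyer.Rank1Residual.X11b.Three.Koly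
  Summit.BirchSwinnertonDyer.BirchSwinnertonDyer.Theorems.CornerLocal

/-- **`stub_kolyJ_max` ⟸ its restriction to the SPLIT multiplicative places.** The conclusion is the registered
stub `stub_kolyJ_max` of 19947 VERBATIM; the hypothesis `hsplit` is the same statement with `v` restricted to
places of split multiplicative reduction, the supplier being GIVEN in addition `c_v = ord_v(Δ_min)`
(Kodaira–Néron) and `p ∣ ord_v(Δ_min)` (the corner: binder 4 at `v ∣ p`, `¬Ram` at `v ∤ p`). At every other
place `ord_p c_v = 0` (`padicValNat_localTamagawaNumber_eq_zero_of_not_split`, `p ∈ {5,7}`), so `s = 0` and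
`PDiv d p 0` holds (`Koly.pdiv_zero`). [cite: Jetchev2008, Thm. 1.4 (shape), §4 (local conditions at v ∣ N)]
[cite: SilvermanATAEC1994, Cor. IV.9.2 (d)] -/
theorem nonSurjCornerKolyJ_max_of_splitPlaces
    (hsplit : ∀ (W : WeierstrassCurve ℚ) [W.IsElliptic] [W.IsGloballyMinimal] [NeZero (W.conductorNorm ℤ)]
      (p : ℕ) [Fact p.Prime] (K : Type) [Field K] [NumberField K]
      (Dt : ModularParametrizationData W (W.conductorNorm ℤ)) (β : ℤ) (ι : K →+* ℂ),
      p ∣ W.tamagawaProduct →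
      ClassX11b W p → ¬ Surj W p → (p = 5 ∨ p = 7) → p ∣ padicValInt p W.minimalDiscriminantInt →
      ¬ Ram W p → IsImaginaryQuadratic K → 4 < (NumberField.discr K).natAbs →
      SatisfiesHeegnerHypothesis (W.conductorNorm ℤ) K → SatisfiesHeegnerHypothesis p K →
      (4 * (W.conductorNorm ℤ : ℤ)) ∣ β ^ 2 - NumberField.discr K → ¬ (p : ℤ) ∣ Dt.c →
      ∀ (v : HeightOneSpectrum (𝓞 ℚ)), W.HasSplitMultiplicativeReductionAt v →
        W.tamagawaNumberAt v = W.ordMinimalDiscriminant v → p ∣ W.ordMinimalDiscriminant v →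
        ∀ (s : ℕ), s ≤ padicValNat p (W.tamagawaNumberAt v) →
          ∀ (n : ℕ) (d : KolyvaginHeegnerData Dt β ι n), Squarefree n →
            (∀ ℓ ∈ n.primeFactors, Zhang2014.IsKolyvaginPrime (W.conductorNorm ℤ) W K p ℓ ∧
              s ≤ Zhang2014.kolyvaginIndex W p ℓ) → PDiv d p s) :
    ∀ (W : WeierstrassCurve ℚ) [W.IsElliptic] [W.IsGloballyMinimal] [NeZero (W.conductorNorm ℤ)]
      (p : ℕ) [Fact p.Prime] (K : Type) [Field K] [NumberField K]
      (Dt : ModularParametrizationData W (W.conductorNorm ℤ)) (β : ℤ) (ι : K →+* ℂ),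
      p ∣ W.tamagawaProduct →
      ClassX11b W p → ¬ Surj W p → (p = 5 ∨ p = 7) → p ∣ padicValInt p W.minimalDiscriminantInt →
      ¬ Ram W p → IsImaginaryQuadratic K → 4 < (NumberField.discr K).natAbs →
      SatisfiesHeegnerHypothesis (W.conductorNorm ℤ) K → SatisfiesHeegnerHypothesis p K →
      (4 * (W.conductorNorm ℤ : ℤ)) ∣ β ^ 2 - NumberField.discr K → ¬ (p : ℤ) ∣ Dt.c →
      ∀ (v : HeightOneSpectrum (𝓞 ℚ)) (s : ℕ), s ≤ padicValNat p (W.tamagawaNumberAt v) →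
        ∀ (n : ℕ) (d : KolyvaginHeegnerData Dt β ι n), Squarefree n →
          (∀ ℓ ∈ n.primeFactors, Zhang2014.IsKolyvaginPrime (W.conductorNorm ℤ) W K p ℓ ∧
            s ≤ Zhang2014.kolyvaginIndex W p ℓ) → PDiv d p s := by
  intro W _ _ _ p _ K _ _ Dt β ι htam hX hns h57 hv hnr hK hd hHN hHp hβ hc v s hs n d hn hℓ
  by_cases hsv : W.HasSplitMultiplicativeReductionAt v
  · have hcv : W.tamagawaNumberAt v = W.ordMinimalDiscriminant v :=
      localTamagawaNumber_eq_ordMinimalDiscriminant_of_split W v hsv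
    exact hsplit W p K Dt β ι htam hX hns h57 hv hnr hK hd hHN hHp hβ hc v hsv hcv
      (NonSurjCorner.dvd_ordMinimalDiscriminant_of_hasMultiplicativeReductionAt W p hX hns
        hsv.hasMultiplicativeReductionAt) s hs n d hn hℓ
  · have hp5 : 5 ≤ p := by rcases h57 with rfl | rfl <;> norm_num
    have h0 : padicValNat p (W.tamagawaNumberAt v) = 0 :=
      padicValNat_localTamagawaNumber_eq_zero_of_not_split W p hp5 v hsv
    rw [h0] at hs
    obtain rfl : s = 0 := Nat.le_zero.mp hs
    exact pdiv_zero d p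

/-- **`stub_kolyJ_max` ⟸ (the corner prime) ∧ (the split primes away from `p`).** As
`nonSurjCornerKolyJ_max_of_splitPlaces`, with the split places separated: `hat` — `v ∣ p` (`primesEquiv v = p`)
split multiplicative, the supplier given `c_p = ord_p Δ_min`, `p ∣ ord_p Δ_min` AND a `ℚ_p`-rational point of
order `p` through any embedding `ι₀ : ℚ̄ → ℚ̄_v` (this seat's `NonSurjCorner.exists_fixed_torsion_of_split`, the
anomalous local type `{1, ω}`); `haway` — `v ∤ p` split multiplicative (`E[p]` unramified at `ℓ`: `p ∣ ord_ℓ Δ_min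
= c_ℓ`). These are the two settings of lane A's CORNER-G7 §1 (component group at `p` ∕ Jetchev's Lemma 4.3 at
`ℓ ≠ p`). [cite: Jetchev2008, Prop. 4.9, Lemma 4.3, Thm. 1.4 (shape)] [cite: SilvermanATAEC1994, Thm. V.5.3, Cor. IV.9.2 (d)] -/
theorem nonSurjCornerKolyJ_max_of_atP_of_awayP
    (hat : ∀ (W : WeierstrassCurve ℚ) [W.IsElliptic] [W.IsGloballyMinimal] [NeZero (W.conductorNorm ℤ)]
      (p : ℕ) [Fact p.Prime] (K : Type) [Field K] [NumberField K]
      (Dt : ModularParametrizationData W (W.conductorNorm ℤ)) (β : ℤ) (ι : K →+* ℂ),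
      p ∣ W.tamagawaProduct →
      ClassX11b W p → ¬ Surj W p → (p = 5 ∨ p = 7) → p ∣ padicValInt p W.minimalDiscriminantInt →
      ¬ Ram W p → IsImaginaryQuadratic K → 4 < (NumberField.discr K).natAbs →
      SatisfiesHeegnerHypothesis (W.conductorNorm ℤ) K → SatisfiesHeegnerHypothesis p K →
      (4 * (W.conductorNorm ℤ : ℤ)) ∣ β ^ 2 - NumberField.discr K → ¬ (p : ℤ) ∣ Dt.c →
      ∀ (v : HeightOneSpectrum (𝓞 ℚ)), (primesEquiv v : ℕ) = p → W.HasSplitMultiplicativeReductionAt v →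
        W.tamagawaNumberAt v = W.ordMinimalDiscriminant v → p ∣ W.ordMinimalDiscriminant v →
        (∀ ι₀ : AlgebraicClosure ℚ →ₐ[ℚ] AlgebraicClosure (v.adicCompletion ℚ),
          ∃ x : geomTorsion W p, x ≠ 0 ∧
            ∀ σ : absoluteGaloisGroup (v.adicCompletion ℚ), resGalOfEmb ι₀ σ • x = x) →
        ∀ (s : ℕ), s ≤ padicValNat p (W.tamagawaNumberAt v) →
          ∀ (n : ℕ) (d : KolyvaginHeegnerData Dt β ι n), Squarefree n →
            (∀ ℓ ∈ n.primeFactors, Zhang2014.IsKolyvaginPrime (W.conductorNorm ℤ) W K p ℓ ∧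
              s ≤ Zhang2014.kolyvaginIndex W p ℓ) → PDiv d p s)
    (haway : ∀ (W : WeierstrassCurve ℚ) [W.IsElliptic] [W.IsGloballyMinimal] [NeZero (W.conductorNorm ℤ)]
      (p : ℕ) [Fact p.Prime] (K : Type) [Field K] [NumberField K]
      (Dt : ModularParametrizationData W (W.conductorNorm ℤ)) (β : ℤ) (ι : K →+* ℂ),
      p ∣ W.tamagawaProduct →
      ClassX11b W p → ¬ Surj W p → (p = 5 ∨ p = 7) → p ∣ padicValInt p W.minimalDiscriminantInt →
      ¬ Ram W p → IsImaginaryQuadratic K → 4 < (NumberField.discr K).natAbs →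
      SatisfiesHeegnerHypothesis (W.conductorNorm ℤ) K → SatisfiesHeegnerHypothesis p K →
      (4 * (W.conductorNorm ℤ : ℤ)) ∣ β ^ 2 - NumberField.discr K → ¬ (p : ℤ) ∣ Dt.c →
      ∀ (v : HeightOneSpectrum (𝓞 ℚ)), (primesEquiv v : ℕ) ≠ p → W.HasSplitMultiplicativeReductionAt v →
        W.tamagawaNumberAt v = W.ordMinimalDiscriminant v → p ∣ W.ordMinimalDiscriminant v →
        ∀ (s : ℕ), s ≤ padicValNat p (W.tamagawaNumberAt v) →
          ∀ (n : ℕ) (d : KolyvaginHeegnerData Dt β ι n), Squarefree n →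
            (∀ ℓ ∈ n.primeFactors, Zhang2014.IsKolyvaginPrime (W.conductorNorm ℤ) W K p ℓ ∧
              s ≤ Zhang2014.kolyvaginIndex W p ℓ) → PDiv d p s) :
    ∀ (W : WeierstrassCurve ℚ) [W.IsElliptic] [W.IsGloballyMinimal] [NeZero (W.conductorNorm ℤ)]
      (p : ℕ) [Fact p.Prime] (K : Type) [Field K] [NumberField K]
      (Dt : ModularParametrizationData W (W.conductorNorm ℤ)) (β : ℤ) (ι : K →+* ℂ),
      p ∣ W.tamagawaProduct →
      ClassX11b W p → ¬ Surj W p → (p = 5 ∨ p = 7) → p ∣ padicValInt p W.minimalDiscriminantInt →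
      ¬ Ram W p → IsImaginaryQuadratic K → 4 < (NumberField.discr K).natAbs →
      SatisfiesHeegnerHypothesis (W.conductorNorm ℤ) K → SatisfiesHeegnerHypothesis p K →
      (4 * (W.conductorNorm ℤ : ℤ)) ∣ β ^ 2 - NumberField.discr K → ¬ (p : ℤ) ∣ Dt.c →
      ∀ (v : HeightOneSpectrum (𝓞 ℚ)) (s : ℕ), s ≤ padicValNat p (W.tamagawaNumberAt v) →
        ∀ (n : ℕ) (d : KolyvaginHeegnerData Dt β ι n), Squarefree n →
          (∀ ℓ ∈ n.primeFactors, Zhang2014.IsKolyvaginPrime (W.conductorNorm ℤ) W K p ℓ ∧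
            s ≤ Zhang2014.kolyvaginIndex W p ℓ) → PDiv d p s := by
  refine nonSurjCornerKolyJ_max_of_splitPlaces ?_
  intro W _ _ _ p _ K _ _ Dt β ι htam hX hns h57 hv hnr hK hd hHN hHp hβ hc v hsv hcv hdv s hs n d hn hℓ
  by_cases hvp : (primesEquiv v : ℕ) = p
  · exact hat W p K Dt β ι htam hX hns h57 hv hnr hK hd hHN hHp hβ hc v hvp hsv hcv hdv
      (fun ι₀ => NonSurjCorner.exists_fixed_torsion_of_split W p hX hns hvp hsv ι₀) s hs n d hn hℓ
  · exact haway W p K Dt β ι htam hX hns h57 hv hnr hK hd hHN hHp hβ hc v hvp hsv hcv hdv s hs n d hn hℓ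

end Summit.BirchSwinnertonDyer.BirchSwinnertonDyer.Theorems

end
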